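import Summits.HubbardSuperconductivity.HubbardSuperconductivity.Theorems.AnisotropyChordBipartiteClassFunction
import Summits.HubbardSuperconductivity.HubbardSuperconductivity.Theorems.AnisotropyChordXXZHoppingFormula
import Mathlib.Combinatorics.SimpleGraph.Maps

/-!
# Route `AnisotropyChord`: AUTOMORPHISM INVARIANCE of the spin-½ XXZ Hamiltonian and of its sector ground
# states (every graph automorphism relabels configurations; on a connected graph the Perron sector ground
# state is fixed) — the symmetry input of the theory seat's VT conjectures and of `UniformSiteDensity`

* `sum_edgeFinset_comp_iso` — edge sums are invariant under `e ↦ φ·e` for `φ : G ≃g G`;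
* `xxz_mulVec_comp_iso` — `(H(Δ) (ψ ∘ R_φ))(σ) = (H(Δ) ψ)(σ ∘ φ)` with `R_φ τ = τ ∘ φ` (the hopping
  formula `xxz_mulVec_apply`, reindexed by `φ` on the edges; `φ ∘ swap_{xy} = swap_{φx,φy} ∘ φ`);
* `comp_iso_mem_weightSector` — relabelling preserves weight sectors;
* `xxz_sectorGroundState_comp_iso` — **on a connected graph every sector ground state of `H(Δ)` is
  invariant under every graph automorphism**: `ψ (σ ∘ φ) = ψ σ` (Perron–Frobenius uniqueness
  `xxz_sector_perron_pos`; the scalar is `1` because the entry sum of the positive vector is preserved).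

Consumers: translation covariance of the Perron vector on tori (`UniformSiteDensity` of the entropy route),
vertex-transitivity arguments of the `U_vt`/TP-VT ladder.  Tasaki (2020) §2.2 (symmetries of spin
Hamiltonians).  No definition is introduced.
-/

set_option linter.dupNamespace false

noncomputable section

namespace Summit.HubbardSuperconductivity.HubbardSuperconductivity.Theorems.AnisotropyChord

open Matrix Complex Finset
open Literature.MathematicalPhysics.QuantumLattice Literature.Probability.LatticeModels
open Summit.HubbardSuperconductivity.HubbardSuperconductivity.Theorems.AnisotropyChord.OneMagnon

variable {V : Type*} [Fintype V] [DecidableEq V]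

omit [DecidableEq V] in
/-- **Edge sums are automorphism-invariant:** `Σ_{e ∈ E(G)} f(φ·e) = Σ_{e ∈ E(G)} f(e)` for
`φ : G ≃g G`. [folklore] -/
theorem sum_edgeFinset_comp_iso (G : SimpleGraph V) [DecidableRel G.Adj] (φ : G ≃g G)
    {M : Type*} [AddCommMonoid M] (f : Sym2 V → M) :
    ∑ e ∈ G.edgeFinset, f (Sym2.map φ e) = ∑ e ∈ G.edgeFinset, f e := by
  refine Finset.sum_bij' (fun e _ => Sym2.map φ e) (fun e _ => Sym2.map φ.symm e) ?_ ?_ ?_ ?_ ?_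
  · intro e he
    revert he
    induction e using Sym2.ind with
    | h x y =>
      intro he
      rw [SimpleGraph.mem_edgeFinset, SimpleGraph.mem_edgeSet] at he
      rw [Sym2.map_mk, SimpleGraph.mem_edgeFinset, SimpleGraph.mem_edgeSet]
      exact φ.map_adj_iff.mpr he
  · intro e he
    revert he
    induction e using Sym2.ind with
    | h x y =>
      intro he
      rw [SimpleGraph.mem_edgeFinset, SimpleGraph.mem_edgeSet] at he
      rw [Sym2.map_mk, SimpleGraph.mem_edgeFinset, SimpleGraph.mem_edgeSet]
      exact φ.symm.map_adj_iff.mpr he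
  · intro e _
    simp [Sym2.map_map]
  · intro e _
    simp [Sym2.map_map]
  · intro e _; rfl

omit [Fintype V] in
/-- `φ ∘ swap_{xy} = swap_{φx, φy} ∘ φ` on configurations: `(σ ∘ φ) ∘ swap x y = (σ ∘ swap (φ x) (φ y)) ∘ φ`.
[folklore] -/
theorem comp_comp_swap_iso {W : Type*} [DecidableEq W] (φ : V ≃ W) (σ : W → Fin 2) (x y : V) :
    (σ ∘ φ) ∘ Equiv.swap x y = (σ ∘ Equiv.swap (φ x) (φ y)) ∘ φ := by
  funext z
  simp only [Function.comp_apply]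
  rw [φ.injective.map_swap]

/-- **The XXZ Hamiltonian commutes with automorphism relabelling:**
`(H(Δ) (τ ↦ ψ (τ ∘ φ)))(σ) = (H(Δ) ψ)(σ ∘ φ)` for every graph automorphism `φ`. [folklore] -/
theorem xxz_mulVec_comp_iso (G : SimpleGraph V) [DecidableRel G.Adj] (Δ : ℝ) (φ : G ≃g G)
    (ψ : (V → Fin 2) → ℂ) (σ : V → Fin 2) :
    ((xxzHamiltonian 1 G (-1) Δ : Op V 2) *ᵥ (fun τ => ψ (τ ∘ φ))) σ =
      ((xxzHamiltonian 1 G (-1) Δ : Op V 2) *ᵥ ψ) (σ ∘ φ) := by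
  rw [xxz_mulVec_apply, xxz_mulVec_apply]
  -- diagonal part: reindex the edge sum by `φ`
  have hdiag : (∑ e ∈ G.edgeFinset, Sym2.lift ⟨fun x y => ((1 : ℝ) / 2 - ((σ ∘ φ) x : ℕ)) *
        ((1 : ℝ) / 2 - ((σ ∘ φ) y : ℕ)), fun _ _ => mul_comm _ _⟩ e) =
      ∑ e ∈ G.edgeFinset, Sym2.lift ⟨fun x y => ((1 : ℝ) / 2 - (σ x : ℕ)) * ((1 : ℝ) / 2 - (σ y : ℕ)),
        fun _ _ => mul_comm _ _⟩ e := by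
    rw [← sum_edgeFinset_comp_iso G φ (fun e => Sym2.lift ⟨fun x y => ((1 : ℝ) / 2 - (σ x : ℕ)) *
      ((1 : ℝ) / 2 - (σ y : ℕ)), fun _ _ => mul_comm _ _⟩ e)]
    refine Finset.sum_congr rfl fun e _ => ?_
    induction e using Sym2.ind with
    | h x y => simp only [Sym2.map_mk, Sym2.lift_mk, Function.comp_apply]
  -- hopping part
  have hhop : (∑ e ∈ G.edgeFinset, Sym2.lift ⟨fun x y => if (σ ∘ φ) x ≠ (σ ∘ φ) y then
        ψ ((σ ∘ φ) ∘ Equiv.swap x y) else 0, fun x y => by simp only [ne_comm, Equiv.swap_comm]⟩ e) =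
      ∑ e ∈ G.edgeFinset, Sym2.lift ⟨fun x y => if σ x ≠ σ y then
        (fun τ => ψ (τ ∘ φ)) (σ ∘ Equiv.swap x y) else 0, fun x y => by simp only [ne_comm, Equiv.swap_comm]⟩ e := by
    rw [← sum_edgeFinset_comp_iso G φ (fun e => Sym2.lift ⟨fun x y => if σ x ≠ σ y then
        (fun τ => ψ (τ ∘ φ)) (σ ∘ Equiv.swap x y) else 0, fun x y => by simp only [ne_comm, Equiv.swap_comm]⟩ e)]
    refine Finset.sum_congr rfl fun e _ => ?_
    induction e using Sym2.ind with
    | h x y =>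
      simp only [Sym2.map_mk, Sym2.lift_mk, Function.comp_apply]
      have hsw : (σ ∘ ⇑φ) ∘ ⇑(Equiv.swap x y) = (σ ∘ ⇑(Equiv.swap (φ x) (φ y))) ∘ ⇑φ :=
        comp_comp_swap_iso φ.toEquiv σ x y
      rw [hsw]
      rfl
  rw [hdiag, hhop]

omit [DecidableEq V] in
/-- Relabelling by an automorphism preserves the weight (number of `1`s). [folklore] -/
theorem weight_comp_equiv (φ : V ≃ V) (σ : V → Fin 2) :
    (∑ z, ((σ ∘ φ) z : ℕ)) = ∑ z, (σ z : ℕ) :=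
  Equiv.sum_comp φ (fun z => (σ z : ℕ))

/-- Relabelled vectors stay in their weight sector. [folklore] -/
theorem comp_iso_mem_weightSector (φ : V ≃ V) (W : ℕ) {ψ : (V → Fin 2) → ℂ}
    (hψ : ψ ∈ spinZSector (Λ := V) 1 (((Fintype.card V * 1 : ℕ) : ℝ) / 2 - W)) :
    (fun τ : V → Fin 2 => ψ (τ ∘ φ)) ∈ spinZSector (Λ := V) 1 (((Fintype.card V * 1 : ℕ) : ℝ) / 2 - W) := by
  rw [LiebMattis.mem_spinZSector_weight_iff] at hψ ⊢
  intro σ hσ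
  exact hψ _ (by rw [weight_comp_equiv]; exact hσ)

/-- The configuration relabelling `τ ↦ τ ∘ φ` as a permutation of configurations. [folklore] -/
theorem sum_comp_equiv_config (φ : V ≃ V) (f : (V → Fin 2) → ℂ) :
    (∑ τ : V → Fin 2, f (τ ∘ φ)) = ∑ τ : V → Fin 2, f τ :=
  Equiv.sum_comp (φ.symm.arrowCongr (Equiv.refl (Fin 2))) f |>.symm.trans (by
    refine (Finset.sum_congr rfl fun τ _ => ?_).trans (Equiv.sum_comp (φ.symm.arrowCongr (Equiv.refl (Fin 2))) f)
    rfl) |>.symm |> fun h => by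
      have key : ∀ τ : V → Fin 2, (φ.symm.arrowCongr (Equiv.refl (Fin 2))) τ = τ ∘ φ := by
        intro τ; funext x; simp [Equiv.arrowCongr_apply]
      calc (∑ τ : V → Fin 2, f (τ ∘ φ)) = ∑ τ, f ((φ.symm.arrowCongr (Equiv.refl (Fin 2))) τ) :=
            Finset.sum_congr rfl fun τ _ => by rw [key]
        _ = ∑ τ, f τ := Equiv.sum_comp _ _

/-- **Sector ground states of `H(Δ)` on a connected graph are automorphism-invariant:** for every
`φ : G ≃g G`, every `Δ`, every weight sector and every `ψ` in it with `H(Δ)ψ = E ψ` at the sector energy,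
`ψ (σ ∘ φ) = ψ σ` (the positive Perron vector is unique up to scale and has the same entry sum as its
relabelling). Tasaki (2020) §2.2. [folklore] -/
theorem xxz_sectorGroundState_comp_iso (G : SimpleGraph V) [DecidableRel G.Adj] (hG : G.Connected)
    (Δ : ℝ) (φ : G ≃g G) (W : ℕ) {ψ : (V → Fin 2) → ℂ}
    (hψK : ψ ∈ spinZSector (Λ := V) 1 (((Fintype.card V * 1 : ℕ) : ℝ) / 2 - W))
    (hHψ : xxzHamiltonian 1 G (-1) Δ *ᵥ ψ =
      ((lowestEnergyInSector 1 (xxzHamiltonian 1 G (-1) Δ)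
        (((Fintype.card V * 1 : ℕ) : ℝ) / 2 - W) : ℝ) : ℂ) • ψ) (σ : V → Fin 2) :
    ψ (σ ∘ φ) = ψ σ := by
  by_cases hψ0 : ψ = 0
  · simp [hψ0]
  have hW : ∃ σ : TensorIndex V 2, (∑ z, (σ z : ℕ)) = W := by
    by_contra h
    push Not at h
    exact hψ0 (funext fun τ => (LiebMattis.mem_spinZSector_weight_iff 1 W ψ).1 hψK τ (h τ))
  obtain ⟨ψ₀, hψ₀K, hψ₀0, hψ₀nn, hψ₀pos, hψ₀off, hHψ₀, huniq⟩ := xxz_sector_perron_pos G hG Δ W hW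
  set H := xxzHamiltonian 1 G (-1) Δ with hH
  set E : ℝ := lowestEnergyInSector 1 H (((Fintype.card V * 1 : ℕ) : ℝ) / 2 - W) with hE
  -- the relabelled Perron vector is again a sector ground state, hence a multiple of `ψ₀`
  set ψ₀' : (V → Fin 2) → ℂ := fun τ => ψ₀ (τ ∘ φ) with hψ₀'
  have hψ₀'K := comp_iso_mem_weightSector φ.toEquiv W hψ₀K
  have hHψ₀' : H *ᵥ ψ₀' = (E : ℂ) • ψ₀' := by
    funext τ
    rw [hψ₀', hH, xxz_mulVec_comp_iso G Δ φ ψ₀ τ, ← hH, hHψ₀, Pi.smul_apply, Pi.smul_apply]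
  obtain ⟨c, hc⟩ := huniq ψ₀' hψ₀'K hHψ₀'
  -- the entry sums agree, so `c = 1`
  have hsum : (∑ τ, ψ₀' τ) = ∑ τ, ψ₀ τ := sum_comp_equiv_config φ.toEquiv ψ₀
  have hsum' : (∑ τ, ψ₀' τ) = c * ∑ τ, ψ₀ τ := by
    rw [hc]; simp only [Pi.smul_apply, smul_eq_mul, Finset.mul_sum]
  have hS0 : (∑ τ, ψ₀ τ) ≠ 0 := by
    obtain ⟨σ₀, hσ₀⟩ := hW
    intro h0
    have hre : (∑ τ, ψ₀ τ).re = 0 := by rw [h0, Complex.zero_re]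
    rw [Complex.re_sum] at hre
    have hle : ∀ τ ∈ (Finset.univ : Finset (V → Fin 2)), 0 ≤ (ψ₀ τ).re := fun τ _ => (hψ₀nn τ).1
    have := (Finset.sum_eq_zero_iff_of_nonneg hle).1 hre σ₀ (Finset.mem_univ _)
    exact (hψ₀pos σ₀ hσ₀).ne' this
  have hc1 : c = 1 := by
    have h := hsum'.symm.trans hsum
    -- c * S = S with S ≠ 0
    have : (c - 1) * ∑ τ, ψ₀ τ = 0 := by rw [sub_mul, one_mul, h, sub_self]
    rcases mul_eq_zero.1 this with h1 | h1
    · exact sub_eq_zero.1 h1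
    · exact absurd h1 hS0
  have hinv₀ : ∀ τ, ψ₀ (τ ∘ φ) = ψ₀ τ := by
    intro τ
    have := congrFun hc τ
    rw [hc1, one_smul] at this
    exact this
  -- the given ground state is a multiple of `ψ₀`
  obtain ⟨c', hc'⟩ := huniq ψ hψK hHψ
  rw [hc', Pi.smul_apply, Pi.smul_apply, hinv₀]

end Summit.HubbardSuperconductivity.HubbardSuperconductivity.Theorems.AnisotropyChord
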